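import Summits.HubbardSuperconductivity.HubbardSuperconductivity.Theorems.ThermalWedgeTwSeededEnsembleEquivalenceRChordReduction
import Summits.HubbardSuperconductivity.HubbardSuperconductivity.Theorems.ThermalWedgeTwSeededEnsembleEquivalenceRFreeConcavityCalibration

/-!
# Calibration of FV-CHORD at the solvable corner `U = 0`
# (crux stmt-HubbardSuperconductivity-15581, line `Sketch` v8.5; pool seat 0, session 74)

Support file (`--supports stmt-HubbardSuperconductivity-15581`; sorry-free; no definition).

`…RChordReduction.lean` reduced the crux `TwSeededEnsembleEquivalenceR` to FV-CHORD (`twR_of_fvChordMonotone`): eventually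
in `L`, the chord pair amplitude `h ↦ Re⟨Δ_d + Δ_dᴴ⟩_{β,L,U,μ,h} / h` of the cold sourced torus is non-increasing on
`(0, 13g+1]`. This file certifies that hypothesis, in its exact finite-volume Gibbs-state form, at `U = 0`:

* `cal_freeChordMonotone_finiteVolume` — for EVERY `β > 0`, `μ`, and torus side `L ≥ 3`, the free chord pair amplitude
  `h ↦ Re⟨Δ_d + Δ_dᴴ⟩_{β,L,0,μ,h} / h` is non-increasing on all of `(0, ∞)` (FV-CONC at `U = 0`,
  `cal_freeConcavity_finiteVolume`, through the torus-by-torus equivalence `chr_fvChord_iff_fvConcavity`);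
* `cal_freeChordMonotone` — the hypothesis of `twR_of_fvChordMonotone` binder for binder with `dWaveSourceTorus L 0 μ h`
  in place of `dWaveSourceTorus L U μ h` and any `β > 0` in place of `e^{a/U}`: it holds with `L₀ = 3` (and
  `a = K' = U₀ = 1`).

So the sign and normalisation conventions of FV-CHORD are the right ones (`dWaveSourceTorus = H − h(Δ_d + Δ_dᴴ)`, induced
amplitude `Re⟨Δ_d + Δ_dᴴ⟩_h ≥ 0` with diminishing returns), and what is left in it is the weak-coupling input `0 < U ≤ U₀`
at `β = e^{a/U}`. [folklore composition]
-/

set_option linter.dupNamespace false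

namespace Summit.HubbardSuperconductivity.HubbardSuperconductivity.Theorems

open Matrix Set Literature.MathematicalPhysics.QuantumLattice
open Summit.HubbardSuperconductivity.HubbardSuperconductivity.Theorems.TwSeededEnsembleEquivalenceR.ColdFloorLine

noncomputable section

/-- **FV-CHORD at `U = 0` (every `β > 0`, `μ`, `L ≥ 3`), on all of `(0, ∞)`.** The free chord pair amplitude
`h ↦ Re⟨Δ_d + Δ_dᴴ⟩_{β,L,0,μ,h} / h` is non-increasing: `cal_freeConcavity_finiteVolume` (each BdG mode concave in the
squared source) through `chr_fvChord_iff_fvConcavity` on `(0, h₂]`. [folklore composition] -/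
theorem cal_freeChordMonotone_finiteVolume (β μ : ℝ) (hβ : 0 < β) (L : ℕ) [NeZero L] (hL : 3 ≤ L) :
    AntitoneOn (fun h : ℝ => (Matrix.gibbsState β (dWaveSourceTorus L 0 μ h)
        (pairField dWaveFormFactor L + (pairField dWaveFormFactor L)ᴴ)).re / h) (Set.Ioi 0) := by
  intro h₁ hh₁ h₂ hh₂ h12
  have hR : 0 < h₂ := hh₂
  have h := (chr_fvChord_iff_fvConcavity L 0 μ hβ hR).mpr
    ((cal_freeConcavity_finiteVolume β μ hβ L hL).subset Set.Icc_subset_Ici_self (convex_Icc _ _))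
  exact h ⟨hh₁, h12⟩ ⟨hh₂, le_rfl⟩ h12

/-- **Calibration of the hypothesis of `twR_of_fvChordMonotone` at `U = 0`** (binder for binder, with
`dWaveSourceTorus L 0 μ h` and any `β > 0` in place of `e^{a/U}`): it holds with `L₀ = 3`. [folklore composition] -/
theorem cal_freeChordMonotone :
    ∀ (β : ℝ), 0 < β → ∀ (μ₁ μ₂ : ℝ), -4 < μ₁ → μ₁ < μ₂ → μ₂ < 0 → ∃ a K' U₀ : ℝ, 0 < a ∧ 0 < K' ∧ 0 < U₀ ∧
      ∀ U ∈ Set.Ioc (0 : ℝ) U₀, ∀ g ∈ Set.Icc (K' * U) (1 / 10), ∀ μ ∈ Set.Ioo μ₁ μ₂,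
        ∃ L₀ : ℕ, ∀ (L : ℕ) [NeZero L], L₀ ≤ L →
          AntitoneOn (fun h : ℝ => (Matrix.gibbsState β (dWaveSourceTorus L 0 μ h)
            (pairField dWaveFormFactor L + (pairField dWaveFormFactor L)ᴴ)).re / h)
            (Set.Ioc 0 (13 * g + 1)) := by
  intro β hβ μ₁ μ₂ _ _ _
  refine ⟨1, 1, 1, one_pos, one_pos, one_pos, fun U _ g _ μ _ => ⟨3, fun L _ hL => ?_⟩⟩
  exact (cal_freeChordMonotone_finiteVolume β μ hβ L hL).mono fun h hh => hh.1

end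

end Summit.HubbardSuperconductivity.HubbardSuperconductivity.Theorems
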